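import Mathlib
import HarnessLib
import Summits.QuantumFields.YangMills.Theorems.PencilRigidityCurvatureKernelBoundSwapFormCauchySchwarz
import Summits.QuantumFields.YangMills.Theorems.PencilRigidityCurvatureKernelBoundSwapReflectionPositivity
import Summits.QuantumFields.YangMills.Theorems.PencilRigidityCurvatureKernelBoundSmearedSwapObservables
import Summits.QuantumFields.YangMills.Theorems.PencilRigidityCurvatureKernelBoundCurvatureSwapCovariance
import Literature.MathematicalPhysics.QuantumFieldTheory.YangMillsOS
import Literature.MathematicalPhysics.QuantumFieldTheory.StrongCouplingClustering
import Literature.MathematicalPhysics.QuantumFieldTheory.Sweep1ShenZhuZhuProofs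

/-!
# `CurvatureKernelBound` — helper `SwapOffDiagonalInfiniteVolumeCS` for brick `SwapOffDiagonalVanishing`
# (crux stmt-QuantumFields-11687, line `coupling-trichotomy`, skeleton v9, wave 3)

Cauchy–Schwarz for the truncated smeared curvature two-point function of the INFINITE-VOLUME
strong-coupling state across the diagonal mirror `{z 0 = z 1}`.

Fix a faithful unitary lattice representation `r` (curvature `Q = r.curvature.F`, the action
density at the origin), a box `{-L,…,L}⁴`, a spacing `0 < a ≤ δ`, a coupling `β ≥ 0`, and box limits
`q = lim_Λ ⟨Q_x⟩_Λ`, `P (y - x) = lim_Λ ⟨Q_x Q_y⟩_Λ` of the free-boundary Wilson states.  Write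
`I(u, v) = a⁸ Σ_{x,y ∈ box} u(a x) v(a y) (P(y − x) − q²)`.  For real test functions `f₀θ, f₁`
supported in the positive half `{δ ≤ z 0 − z 1}` and their lattice mirror images `f₀, f₁θ`
(`f₀ (a x) = f₀θ (a (x ∘ swap 0 1))`, `f₁θ (a x) = f₁ (a (x ∘ swap 0 1))`),
`I(f₀, f₁)² ≤ I(f₁θ, f₁) · I(f₀, f₀θ)`.

Proof: the smeared fields `X = Φ(f₁)`, `Y = Φ(f₀θ)` are bounded measurable functions of finitely
many positive links (`SmearedPositiveHalfSupport`), `X ∘ Θ = Φ(f₁θ)`, `Y ∘ Θ = Φ(f₀)`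
(`SmearedCurvatureSwapCovariance`), the finite-volume states are reflection positive
(`SwapReflectionPositivity`) and `Θ`-invariant (`ZdExpectSwapInvariant`), and the five box limits of
`⟨X⟩, ⟨Y⟩, ⟨X·X∘Θ⟩, ⟨Y·Y∘Θ⟩, ⟨X·Y∘Θ⟩` are finite sums of the limits `q`, `P` (linearity of the
finite-volume expectation); `SwapFormCauchySchwarz` then gives the inequality after expanding the
centred form (`Σ_x fθ(a x) = Σ_x f(a x)` over the swap-symmetric box).
-/

noncomputable section

open scoped BigOperators Topology SchwartzMap
open MeasureTheory Filter Set
open Literature.MathematicalPhysics.QuantumLattice Literature.MathematicalPhysics.QuantumFieldTheory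
  Literature.Probability.LatticeModels

namespace Summit.QuantumFields.YangMills.Theorems.CurvatureKernel

namespace SwapOffDiag

/-! ## Finite-sum algebra -/

/-- Reindexing a sum over the swap-symmetric box `{-L,…,L}⁴` by `x ↦ x ∘ swap 0 1`. [folklore] -/
theorem sum_box_comp_swap (L : ℕ) (φ : Site 4 → ℝ) :
    ∑ x ∈ box 4 L, φ (x ∘ Equiv.swap (0 : Fin 4) 1) = ∑ x ∈ box 4 L, φ x :=
  Finset.sum_nbij' (fun x => x ∘ ⇑(Equiv.swap (0 : Fin 4) 1))
    (fun x => x ∘ ⇑(Equiv.swap (0 : Fin 4) 1))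
    (fun _ hx => comp_swap_mem_box 0 1 hx) (fun _ hx => comp_swap_mem_box 0 1 hx)
    (fun x _ => comp_swap_comp_swap 0 1 x) (fun x _ => comp_swap_comp_swap 0 1 x) (fun _ _ => rfl)

/-- Expansion of the centred form: `a⁸ ΣΣ u v P − (a⁴ Σ u q)(a⁴ Σ v q) = a⁸ ΣΣ u v (P − q²)`.
[folklore] -/
theorem centred_form_eq (S : Finset (Site 4)) (u v : Site 4 → ℝ) (Pk : Site 4 → Site 4 → ℝ)
    (q a : ℝ) :
    a ^ 8 * ∑ x ∈ S, ∑ y ∈ S, u x * v y * Pk x y -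
        (a ^ 4 * ∑ x ∈ S, u x * q) * (a ^ 4 * ∑ y ∈ S, v y * q) =
      a ^ 8 * ∑ x ∈ S, ∑ y ∈ S, u x * v y * (Pk x y - q ^ 2) := by
  rw [show (a ^ 4 * ∑ x ∈ S, u x * q) * (a ^ 4 * ∑ y ∈ S, v y * q) =
      a ^ 8 * ((∑ x ∈ S, u x * q) * (∑ y ∈ S, v y * q)) by ring, Finset.sum_mul_sum, ← mul_sub,
    ← Finset.sum_sub_distrib]
  congr 1
  refine Finset.sum_congr rfl fun x _ => ?_
  rw [← Finset.sum_sub_distrib]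
  refine Finset.sum_congr rfl fun y _ => ?_
  ring

/-! ## Finite-volume expectations of smeared curvature fields -/

section Expect

variable {G : Type} [Group G] [TopologicalSpace G] [IsTopologicalGroup G] [CompactSpace G]
  [MeasurableSpace G] [BorelSpace G]

/-- The translated curvature `Q ∘ τ₋ₓ` is integrable for every free-boundary Wilson state
(bounded and measurable; the state is a probability measure). [folklore] -/
theorem integrable_curvature_configShift (r : LatticeRep G) (β : ℝ) (Λ : Finset (Site 4))
    (x : Site 4) :
    Integrable (fun U : ZdGaugeConfig 4 G => r.curvature.F (Literature.MathematicalPhysics.QuantumLattice.configShift (-x) U))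
      (zdWilsonMeasure (d := 4) r.ρ β Λ) := by
  haveI := isProbabilityMeasure_zdWilsonMeasure (d := 4) r.ρ r.continuous β Λ
  obtain ⟨C, hC⟩ := r.curvature.bounded
  exact Integrable.of_bound
    ((r.curvature.measurable.comp (Literature.MathematicalPhysics.QuantumLattice.configShift (-x)).measurable).aestronglyMeasurable) C
    (ae_of_all _ fun U => by rw [Real.norm_eq_abs]; exact hC _)

/-- The product of two translated curvatures is integrable for every free-boundary Wilson state.
[folklore] -/
theorem integrable_curvature_configShift_mul (r : LatticeRep G) (β : ℝ) (Λ : Finset (Site 4))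
    (x y : Site 4) :
    Integrable (fun U : ZdGaugeConfig 4 G =>
      r.curvature.F (Literature.MathematicalPhysics.QuantumLattice.configShift (-x) U) * r.curvature.F (Literature.MathematicalPhysics.QuantumLattice.configShift (-y) U))
      (zdWilsonMeasure (d := 4) r.ρ β Λ) := by
  obtain ⟨C, hC⟩ := r.curvature.bounded
  exact (integrable_curvature_configShift r β Λ x).mul_bdd
    ((r.curvature.measurable.comp (Literature.MathematicalPhysics.QuantumLattice.configShift (-y)).measurable).aestronglyMeasurable) (c := C)
    (ae_of_all _ fun U => by rw [Real.norm_eq_abs]; exact hC _)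

/-- **Linearity, one field**: `⟨Φ(g)⟩_Λ = a⁴ Σ_x g(a x) ⟨Q_x⟩_Λ`. [folklore] -/
theorem zdExpect_smeared (r : LatticeRep G) (β : ℝ) (Λ : Finset (Site 4)) (L : ℕ) (a : ℝ)
    (g : 𝓢(EuclideanSpace ℝ (Fin 4), ℝ)) :
    zdExpect r.ρ β Λ (smearedLatticeField r.curvature.F (box 4 L) a 1 0 g) =
      a ^ 4 * ∑ x ∈ box 4 L, g (a • siteToE x) *
        zdExpect r.ρ β Λ (r.curvature.F ∘ ZdGaugeConfig.translate x) := by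
  simp only [zdExpect, SwapRP.smearedLatticeField_one_zero, translate_eq_configShift,
    Function.comp_apply]
  rw [integral_const_mul, integral_finsetSum _ fun x _ =>
    (integrable_curvature_configShift r β Λ x).const_mul _]
  simp only [integral_const_mul]

/-- **Linearity, two fields**: `⟨Φ(g) Φ(h)⟩_Λ = a⁸ Σ_x Σ_y g(a x) h(a y) ⟨Q_x Q_y⟩_Λ`. [folklore] -/
theorem zdExpect_smeared_mul (r : LatticeRep G) (β : ℝ) (Λ : Finset (Site 4)) (L : ℕ) (a : ℝ)
    (g h : 𝓢(EuclideanSpace ℝ (Fin 4), ℝ)) :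
    zdExpect r.ρ β Λ (fun U => smearedLatticeField r.curvature.F (box 4 L) a 1 0 g U *
        smearedLatticeField r.curvature.F (box 4 L) a 1 0 h U) =
      a ^ 8 * ∑ x ∈ box 4 L, ∑ y ∈ box 4 L, g (a • siteToE x) * h (a • siteToE y) *
        zdExpect r.ρ β Λ (fun U => r.curvature.F (ZdGaugeConfig.translate x U) *
          r.curvature.F (ZdGaugeConfig.translate y U)) := by
  have hpt : ∀ U : ZdGaugeConfig 4 G, smearedLatticeField r.curvature.F (box 4 L) a 1 0 g U *
      smearedLatticeField r.curvature.F (box 4 L) a 1 0 h U =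
      a ^ 8 * ∑ x ∈ box 4 L, ∑ y ∈ box 4 L, g (a • siteToE x) * h (a • siteToE y) *
        (r.curvature.F (Literature.MathematicalPhysics.QuantumLattice.configShift (-x) U) * r.curvature.F (Literature.MathematicalPhysics.QuantumLattice.configShift (-y) U)) := by
    intro U
    rw [SwapRP.smearedLatticeField_one_zero, SwapRP.smearedLatticeField_one_zero,
      mul_mul_mul_comm, ← pow_add, Finset.sum_mul_sum]
    refine congrArg₂ _ (by norm_num) (Finset.sum_congr rfl fun x _ =>
      Finset.sum_congr rfl fun y _ => ?_)
    ring
  simp only [zdExpect, hpt, translate_eq_configShift]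
  rw [integral_const_mul, integral_finsetSum _ fun x _ => integrable_finsetSum _ fun y _ =>
    (integrable_curvature_configShift_mul r β Λ x y).const_mul _]
  congr 1
  refine Finset.sum_congr rfl fun x _ => ?_
  rw [integral_finsetSum _ fun y _ => (integrable_curvature_configShift_mul r β Λ x y).const_mul _]
  refine Finset.sum_congr rfl fun y _ => ?_
  rw [integral_const_mul]

/-- **Box limit of one smeared field**: `⟨Φ(g)⟩_Λ → a⁴ Σ_x g(a x) q`. [folklore] -/
theorem hasBoxLimit_smeared (r : LatticeRep G) (β : ℝ) (L : ℕ) (a : ℝ)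
    (g : 𝓢(EuclideanSpace ℝ (Fin 4), ℝ)) (q : ℝ)
    (hq : ∀ x : Site 4, HasBoxLimit
      (fun Λ => zdExpect r.ρ β Λ (r.curvature.F ∘ ZdGaugeConfig.translate x)) q) :
    HasBoxLimit (fun Λ => zdExpect r.ρ β Λ (smearedLatticeField r.curvature.F (box 4 L) a 1 0 g))
      (a ^ 4 * ∑ x ∈ box 4 L, g (a • siteToE x) * q) := by
  unfold HasBoxLimit
  simp only [zdExpect_smeared]
  exact (tendsto_finsetSum _ fun x _ => (hq x).const_mul _).const_mul _

/-- **Box limit of a product of smeared fields**: `⟨Φ(g) Φ(h)⟩_Λ → a⁸ ΣΣ g(a x) h(a y) P(y − x)`.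
[folklore] -/
theorem hasBoxLimit_smeared_mul (r : LatticeRep G) (β : ℝ) (L : ℕ) (a : ℝ)
    (g h : 𝓢(EuclideanSpace ℝ (Fin 4), ℝ)) (P : Site 4 → ℝ)
    (hP : ∀ x y : Site 4, HasBoxLimit (fun Λ => zdExpect r.ρ β Λ (fun U =>
      r.curvature.F (ZdGaugeConfig.translate x U) * r.curvature.F (ZdGaugeConfig.translate y U)))
      (P (y - x))) :
    HasBoxLimit (fun Λ => zdExpect r.ρ β Λ (fun U =>
        smearedLatticeField r.curvature.F (box 4 L) a 1 0 g U *
          smearedLatticeField r.curvature.F (box 4 L) a 1 0 h U))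
      (a ^ 8 * ∑ x ∈ box 4 L, ∑ y ∈ box 4 L, g (a • siteToE x) * h (a • siteToE y) *
        P (y - x)) := by
  unfold HasBoxLimit
  simp only [zdExpect_smeared_mul]
  exact (tendsto_finsetSum _ fun x _ => tendsto_finsetSum _ fun y _ =>
    (hP x y).const_mul _).const_mul _

end Expect

end SwapOffDiag

/-! ## The registered helper theorem -/

open SwapOffDiag in
/-- **Infinite-volume Cauchy–Schwarz across the diagonal mirror.** For `0 < a ≤ δ`, `0 ≤ β`, box
limits `q` of `⟨Q_x⟩_Λ` and `P (y - x)` of `⟨Q_x Q_y⟩_Λ` (`Q` the curvature of `r`), real test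
functions `f₀θ, f₁` supported in `{δ ≤ z 0 - z 1}` and lattice mirror images `f₀, f₁θ`
(`f₀ (a x) = f₀θ (a (x ∘ swap 0 1))`, `f₁θ (a x) = f₁ (a (x ∘ swap 0 1))`), the truncated sums
`I(u, v) = a⁸ Σ_{x,y ∈ box L} u(a x) v(a y) (P(y − x) − q²)` satisfy
`I(f₀, f₁)² ≤ I(f₁θ, f₁) · I(f₀, f₀θ)` (REGISTERED signature). [folklore] -/
theorem SwapOffDiagonalInfiniteVolumeCS : ∀ (G : Type) [Group G] [TopologicalSpace G] [IsTopologicalGroup G] [CompactSpace G] [MeasurableSpace G] [BorelSpace G] (r : Literature.MathematicalPhysics.QuantumFieldTheory.LatticeRep G) (L : ℕ) (a δ β : ℝ), 0 < a → a ≤ δ → 0 ≤ β → ∀ (q : ℝ) (P : Literature.Probability.LatticeModels.Site 4 → ℝ), (∀ x : Literature.Probability.LatticeModels.Site 4, Literature.Probability.LatticeModels.HasBoxLimit (fun Λ => Literature.MathematicalPhysics.QuantumFieldTheory.zdExpect r.ρ β Λ (r.curvature.F ∘ Literature.MathematicalPhysics.QuantumFieldTheory.ZdGaugeConfig.translate x))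 q) → (∀ x y : Literature.Probability.LatticeModels.Site 4, Literature.Probability.LatticeModels.HasBoxLimit (fun Λ => Literature.MathematicalPhysics.QuantumFieldTheory.zdExpect r.ρ β Λ (fun U => r.curvature.F (Literature.MathematicalPhysics.QuantumFieldTheory.ZdGaugeConfig.translate x U) * r.curvature.F (Literature.MathematicalPhysics.QuantumFieldTheory.ZdGaugeConfig.translate y U))) (P (y - x))) → ∀ (f₀ f₀θ f₁ f₁θ : SchwartzMap (EuclideanSpace ℝ (Fin 4)) ℝ), (∀ z ∈ tsupport (f₀θ : EuclideanSpace ℝ (Fin 4) → ℝ), δ ≤ z 0 - z 1) → (∀ z ∈ tsupport (f₁ : EuclideanSpace ℝ (Fin 4) → ℝ), δ ≤ z 0 - z 1) → (∀ x : Literature.Probability.LatticeModels.Site 4, f₀ (a • Literature.MathematicalPhysics.QuantumLattice.siteToE x) = f₀θ (a • Literature.MathematicalPhysics.QuantumLattice.siteToE (x ∘ Equiv.swap (0 : Fin 4) 1))) → (∀ x : Literature.Probability.LatticeModels.Site 4, f₁θ (a • Literature.MathematicalPhysics.QuantumLattice.siteToE x) = f₁ (a • Literature.MathematicalPhysics.QuantumLattice.siteToE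 (x ∘ Equiv.swap (0 : Fin 4) 1))) → (a ^ 8 * ∑ x ∈ Literature.Probability.LatticeModels.box 4 L, ∑ y ∈ Literature.Probability.LatticeModels.box 4 L, f₀ (a • Literature.MathematicalPhysics.QuantumLattice.siteToE x) * f₁ (a • Literature.MathematicalPhysics.QuantumLattice.siteToE y) * (P (y - x) - q ^ 2)) ^ 2 ≤ (a ^ 8 * ∑ x ∈ Literature.Probability.LatticeModels.box 4 L, ∑ y ∈ Literature.Probability.LatticeModels.box 4 L, f₁θ (a • Literature.MathematicalPhysics.QuantumLattice.siteToE x) * f₁ (a • Literature.MathematicalPhysics.QuantumLattice.siteToE y) * (P (y - x) - q ^ 2)) * (a ^ 8 * ∑ x ∈ Literature.Probability.LatticeModels.box 4 L, ∑ y ∈ Literature.Probability.LatticeModels.box 4 L, f₀ (a • Literature.MathematicalPhysics.QuantumLattice.siteToE x) * f₀θ (a • Literature.MathematicalPhysics.QuantumLattice.siteToE y) * (P (y - x) - q ^ 2)) := by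
  intro G _ _ _ _ _ _ r L a δ β ha haδ hβ q P hq hP f₀ f₀θ f₁ f₁θ hs₀ hs₁ h₀ h₁
  haveI : T2Space G := (r.continuous.isClosedEmbedding r.injective).isEmbedding.t2Space
  haveI : SecondCountableTopology G :=
    (r.continuous.isClosedEmbedding r.injective).isEmbedding.secondCountableTopology
  obtain ⟨C, hC⟩ := r.curvature.bounded
  -- the two positive-half observables `X = Φ(f₁)`, `Y = Φ(f₀θ)`
  obtain ⟨⟨BX, hBX, hXdep⟩, hXm, hXb⟩ :=
    SmearedPositiveHalfSupport r 0 1 (by decide) L a δ ha haδ f₁ hs₁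
  obtain ⟨⟨BY, hBY, hYdep⟩, hYm, hYb⟩ :=
    SmearedPositiveHalfSupport r 0 1 (by decide) L a δ ha haδ f₀θ hs₀
  -- their mirror images `X ∘ Θ = Φ(f₁θ)`, `Y ∘ Θ = Φ(f₀)`
  have hXΘ : ∀ U : ZdGaugeConfig 4 G, smearedLatticeField r.curvature.F (box 4 L) a 1 0 f₁
      (fun e : Site 4 × Fin 4 => U (e.1 ∘ Equiv.swap 0 1, Equiv.swap 0 1 e.2)) =
      smearedLatticeField r.curvature.F (box 4 L) a 1 0 f₁θ U :=
    SmearedCurvatureSwapCovariance r.ρ r.mem_unitary 0 1 L a 1 0 f₁ f₁θ h₁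
  have hYΘ : ∀ U : ZdGaugeConfig 4 G, smearedLatticeField r.curvature.F (box 4 L) a 1 0 f₀θ
      (fun e : Site 4 × Fin 4 => U (e.1 ∘ Equiv.swap 0 1, Equiv.swap 0 1 e.2)) =
      smearedLatticeField r.curvature.F (box 4 L) a 1 0 f₀ U :=
    SmearedCurvatureSwapCovariance r.ρ r.mem_unitary 0 1 L a 1 0 f₀θ f₀ h₀
  -- the three products, reordered
  have eXX : (fun U : ZdGaugeConfig 4 G => smearedLatticeField r.curvature.F (box 4 L) a 1 0 f₁ U *
      smearedLatticeField r.curvature.F (box 4 L) a 1 0 f₁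
        (fun e : Site 4 × Fin 4 => U (e.1 ∘ Equiv.swap 0 1, Equiv.swap 0 1 e.2))) =
      fun U => smearedLatticeField r.curvature.F (box 4 L) a 1 0 f₁θ U *
        smearedLatticeField r.curvature.F (box 4 L) a 1 0 f₁ U := by
    funext U; rw [hXΘ U, mul_comm]
  have eYY : (fun U : ZdGaugeConfig 4 G => smearedLatticeField r.curvature.F (box 4 L) a 1 0 f₀θ U *
      smearedLatticeField r.curvature.F (box 4 L) a 1 0 f₀θ
        (fun e : Site 4 × Fin 4 => U (e.1 ∘ Equiv.swap 0 1, Equiv.swap 0 1 e.2))) =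
      fun U => smearedLatticeField r.curvature.F (box 4 L) a 1 0 f₀ U *
        smearedLatticeField r.curvature.F (box 4 L) a 1 0 f₀θ U := by
    funext U; rw [hYΘ U, mul_comm]
  have eXY : (fun U : ZdGaugeConfig 4 G => smearedLatticeField r.curvature.F (box 4 L) a 1 0 f₁ U *
      smearedLatticeField r.curvature.F (box 4 L) a 1 0 f₀θ
        (fun e : Site 4 × Fin 4 => U (e.1 ∘ Equiv.swap 0 1, Equiv.swap 0 1 e.2))) =
      fun U => smearedLatticeField r.curvature.F (box 4 L) a 1 0 f₀ U *
        smearedLatticeField r.curvature.F (box 4 L) a 1 0 f₁ U := by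
    funext U; rw [hYΘ U, mul_comm]
  -- the five box limits
  have hx := hasBoxLimit_smeared r β L a f₁ q hq
  have hy := hasBoxLimit_smeared r β L a f₀θ q hq
  have hxx := hasBoxLimit_smeared_mul r β L a f₁θ f₁ P hP
  have hyy := hasBoxLimit_smeared_mul r β L a f₀ f₀θ P hP
  have hxy := hasBoxLimit_smeared_mul r β L a f₀ f₁ P hP
  rw [← eXX] at hxx
  rw [← eYY] at hyy
  rw [← eXY] at hxy
  -- Cauchy–Schwarz for the reflection-positive form
  have hCS := SwapFormCauchySchwarz r.N G r.ρ 0 1 β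
    (fun L' Y' B hm hb hd hB =>
      SwapReflectionPositivity r.ρ r.continuous r.mem_unitary 0 1 (by decide) β hβ L' Y' B hm hb hd hB)
    (ZdExpectSwapInvariant r.ρ r.continuous r.mem_unitary 0 1 β) _ _ hXm hYm ⟨_, hXb C hC⟩
    ⟨_, hYb C hC⟩ BX BY hXdep hYdep hBX hBY _ _ _ _ _ hx hy hxx hyy hxy
  -- `Σ_x fθ(a x) = Σ_x f(a x)` over the swap-symmetric box
  have hsum₀ : ∑ x ∈ box 4 L, f₀ (a • siteToE x) * q = ∑ x ∈ box 4 L, f₀θ (a • siteToE x) * q := by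
    simp only [h₀]
    exact sum_box_comp_swap L fun x => f₀θ (a • siteToE x) * q
  have hsum₁ : ∑ x ∈ box 4 L, f₁θ (a • siteToE x) * q = ∑ x ∈ box 4 L, f₁ (a • siteToE x) * q := by
    simp only [h₁]
    exact sum_box_comp_swap L fun x => f₁ (a • siteToE x) * q
  have e1 : (a ^ 4 * ∑ x ∈ box 4 L, f₁ (a • siteToE x) * q) ^ 2 =
      (a ^ 4 * ∑ x ∈ box 4 L, f₁θ (a • siteToE x) * q) *
        (a ^ 4 * ∑ x ∈ box 4 L, f₁ (a • siteToE x) * q) := by rw [sq, hsum₁]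
  have e2 : (a ^ 4 * ∑ x ∈ box 4 L, f₀θ (a • siteToE x) * q) ^ 2 =
      (a ^ 4 * ∑ x ∈ box 4 L, f₀ (a • siteToE x) * q) *
        (a ^ 4 * ∑ x ∈ box 4 L, f₀θ (a • siteToE x) * q) := by rw [sq, hsum₀]
  have e3 : (a ^ 4 * ∑ x ∈ box 4 L, f₁ (a • siteToE x) * q) *
      (a ^ 4 * ∑ x ∈ box 4 L, f₀θ (a • siteToE x) * q) =
      (a ^ 4 * ∑ x ∈ box 4 L, f₀ (a • siteToE x) * q) *
        (a ^ 4 * ∑ x ∈ box 4 L, f₁ (a • siteToE x) * q) := by rw [mul_comm, hsum₀]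
  rw [e1, e2, e3, centred_form_eq, centred_form_eq, centred_form_eq] at hCS
  exact hCS

end Summit.QuantumFields.YangMills.Theorems.CurvatureKernel

end
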